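import Literature.Topology.PlaneTopology.OsgoodArcLimit
import HarnessLib

/-!
# Osgood arcs IV: a Jordan arc of positive area (Osgood 1903)

Topic: Topology / PlaneTopology. **Osgood's theorem**: there is a Jordan arc in the plane — a
continuous injective image of `[0, 1]` — of positive planar Lebesgue measure (W. F. Osgood,
*A Jordan curve of positive area*, Trans. Amer. Math. Soc. 4 (1903) 107–112). We realise it in
the normal form used downstream (`exists_osgoodArc`): `γ : ℝ → ℂ` continuous, injective on
`[0, 1]`, `γ 0 = 0`, `γ 1 = 1`, `γ([0, 1]) ⊆ [0, 1]²`, `volume (γ '' [0, 1]) > 0`.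

Construction (files `OsgoodArcGlue`, `OsgoodArcCells`, `OsgoodArcLimit`): the curve
`OsgoodArc.lim root` of the root cell `[0, 1/2] × [0, 1]` threads the fat Cantor dust
`dust root` (area `≥ 1/4`) from `0` to `1/2 + i`; here we show that it **covers the dust**
(`dust_subset_image`: every dust point is a limit of curve points, and the trace is compact) and
append the two segments `1/2 + i → 3/4 + i/2 → 1` (one more instance of the ternary gluing and of
the separation lemma) to reach the end-point `1` inside the unit square.

Everything proved. Mathlib anchors: `MeasureTheory.volume` on `ℂ` (`Complex.measureSpace`),
`IsCompact.image`, `Metric.mem_closure_iff`.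
-/

noncomputable section

open Set Filter _root_.Topology _root_.MeasureTheory

namespace Literature.Topology.PlaneTopology

namespace OsgoodArc

/-! ### The curve of a cell covers its dust -/

/-- Every point of a depth-`n` level set is within `diam (k + n)` of the curve. [folklore] -/
theorem exists_dist_lim_le : ∀ (n : ℕ) (Q : Cell), ∀ z ∈ levelSet n Q,
    ∃ t ∈ Icc (0 : ℝ) 1, dist (lim Q t) z ≤ diam (Q.k + n)
  | 0, Q, z, hz => ⟨0, ⟨le_rfl, zero_le_one⟩, by
      rw [lim_zero]; exact Q.dist_le_diam Q.entry_mem_rect hz⟩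
  | n + 1, Q, z, hz => by
    rcases hz with hz | hz
    · obtain ⟨t, ht, hd⟩ := exists_dist_lim_le n Q.fst z hz
      refine ⟨t / 3, ⟨by linarith [ht.1], by linarith [ht.2]⟩, ?_⟩
      rw [lim_div_three Q ht]
      rwa [Cell.fst_k, show Q.k + 1 + n = Q.k + (n + 1) by ring] at hd
    · obtain ⟨t, ht, hd⟩ := exists_dist_lim_le n Q.snd z hz
      refine ⟨(t + 2) / 3, ⟨by linarith [ht.1], by linarith [ht.2]⟩, ?_⟩
      rw [lim_add_two_div_three Q ht]
      rwa [Cell.snd_k, show Q.k + 1 + n = Q.k + (n + 1) by ring] at hd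

/-- **The curve of a cell covers its dust.** [folklore] -/
theorem dust_subset_image (Q : Cell) : dust Q ⊆ lim Q '' Icc 0 1 := by
  intro z hz
  have hc : IsClosed (lim Q '' Icc 0 1) := (isCompact_Icc.image (continuous_lim Q)).isClosed
  rw [← hc.closure_eq, Metric.mem_closure_iff]
  intro ε hε
  obtain ⟨N, hN⟩ := diam_eventually_lt hε
  obtain ⟨t, ht, hd⟩ := exists_dist_lim_le N Q z (mem_iInter.1 hz N)
  exact ⟨lim Q t, mem_image_of_mem _ ht, by rw [dist_comm]; exact hd.trans_lt (hN _ (by omega))⟩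

/-! ### The Osgood arc -/

/-- The corner point `3/4 + i/2` of the final two-segment tail of the arc. [folklore] -/
def tailPt : ℂ := (3 / 4 : ℝ) + (1 / 2 : ℝ) * Complex.I

/-- **Osgood's arc**: the fat-dust curve of the root cell `[0, 1/2] × [0, 1]` from `0` to
`1/2 + i`, followed by the segments `1/2 + i → 3/4 + i/2 → 1`. [folklore] -/
def osgoodArc : ℝ → ℂ := glue (lim root) (seg tailPt 1) root.exit tailPt

/-- The exit corner of the root cell is `1/2 + i`. [folklore] -/
theorem root_exit : root.exit = (1 / 2 : ℝ) + (1 : ℝ) * Complex.I := by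
  simp [Cell.exit, root, width, height]

/-- The rectangle of the root cell is `[0, 1/2] × [0, 1]`. [folklore] -/
theorem root_rect : root.rect = Icc 0 (1 / 2) ×ℂ Icc 0 1 := by
  simp [Cell.rect, root, width, height]

/-- The Osgood arc is continuous. [folklore] -/
theorem continuous_osgoodArc : Continuous osgoodArc :=
  continuous_glue (continuous_lim root) (continuous_seg _ _) (lim_one root) (seg_zero _ _)

/-- The Osgood arc starts at `0`. [folklore] -/
theorem osgoodArc_zero : osgoodArc 0 = 0 := by
  rw [osgoodArc, glue_zero, lim_zero]; rfl

/-- The Osgood arc ends at `1`. [folklore] -/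
theorem osgoodArc_one : osgoodArc 1 = 1 := by
  rw [osgoodArc, glue_one, seg_one]

/-- The tail corner lies in the box `[3/4, 1] × [0, 1/2]`. [folklore] -/
theorem tailPt_mem : tailPt ∈ Icc (3 / 4) 1 ×ℂ Icc 0 (1 / 2) := by
  simp only [mem_box, tailPt, Complex.add_re, Complex.ofReal_re, Complex.mul_re, Complex.I_re,
    Complex.ofReal_im, Complex.I_im, Complex.add_im, Complex.mul_im]
  norm_num

/-- The end-point `1` lies in the box `[3/4, 1] × [0, 1/2]`. [folklore] -/
theorem one_mem_tailBox : (1 : ℂ) ∈ Icc (3 / 4) 1 ×ℂ Icc 0 (1 / 2) := by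
  simp only [mem_box, Complex.one_re, Complex.one_im]; norm_num

/-- **The Osgood arc is injective on `[0, 1]`** (separation lemma with `δ = 0`: the root cell
`[0, 1/2] × [0, 1]` and the tail box `[3/4, 1] × [0, 1/2]` are disjoint and the open bridge
`1/2 + i → 3/4 + i/2` has real part in `(1/2, 3/4)`). [folklore] -/
theorem injOn_osgoodArc : InjOn osgoodArc (Icc 0 1) := by
  intro s hs t ht hst
  have h := glue_sep (A := root.rect) (B := Icc (3 / 4) 1 ×ℂ Icc 0 (1 / 2)) (δ := 0) le_rfl
    (fun _ hu => lim_mem_rect root hu) (fun _ hu => seg_mem_box tailPt_mem one_mem_tailBox hu)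
    ?_ ?_ ?_ (seg_zero _ _) (fun s hs t ht h => by rw [injOn_lim root hs ht h, sub_self, abs_zero])
    (fun s _ t _ h => by
      rw [injective_seg (by
        intro h1; have := congrArg Complex.re h1; norm_num [tailPt] at this) h, sub_self, abs_zero])
    hs ht hst
  · have : |s - t| ≤ 0 := by simpa using h
    linarith [abs_nonneg (s - t), abs_eq_zero.1 (le_antisymm this (abs_nonneg _))]
  · rw [root_rect, Set.disjoint_left]
    intro z h1 h2
    rw [mem_box] at h1 h2
    linarith [h1.1.2, h2.1.1]
  · intro h
    have := congrArg Complex.re h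
    rw [root_exit] at this
    norm_num [tailPt] at this
  · intro u hu
    have hre : (seg root.exit tailPt u).re = 1 / 2 + u * (1 / 4) := by
      rw [seg_re, root_exit]; norm_num [tailPt]
    rw [root_rect]
    constructor <;> intro hz <;> rw [mem_box] at hz <;> nlinarith [hz.1.1, hz.1.2, hu.1, hu.2]

/-- The Osgood arc stays in the unit square on `[0, 1]`. [folklore] -/
theorem osgoodArc_mem {t : ℝ} (ht : t ∈ Icc (0 : ℝ) 1) : osgoodArc t ∈ Icc 0 1 ×ℂ Icc 0 1 := by
  have hsq : ∀ z : ℂ, z ∈ Icc 0 (1 / 2) ×ℂ Icc 0 1 ∨ z ∈ Icc (3 / 4) 1 ×ℂ Icc 0 (1 / 2) →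
      z ∈ Icc 0 1 ×ℂ Icc 0 1 := by
    intro z hz
    rw [mem_box]
    rcases hz with hz | hz <;> rw [mem_box] at hz
    · exact ⟨⟨hz.1.1, by linarith [hz.1.2]⟩, hz.2⟩
    · exact ⟨⟨by linarith [hz.1.1], hz.1.2⟩, hz.2.1, by linarith [hz.2.2]⟩
  have hexit : root.exit ∈ Icc 0 1 ×ℂ Icc 0 1 := hsq _ (Or.inl (root_rect ▸ root.exit_mem_rect))
  exact glue_mem (fun u hu => hsq _ (Or.inl (root_rect ▸ lim_mem_rect root hu)))
    (fun u hu => hsq _ (Or.inr (seg_mem_box tailPt_mem one_mem_tailBox hu)))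
    (fun u hu => seg_mem_box hexit (hsq _ (Or.inr tailPt_mem)) hu) ht

/-- The trace of the root-cell curve is part of the trace of the Osgood arc. [folklore] -/
theorem image_lim_root_subset : lim root '' Icc 0 1 ⊆ osgoodArc '' Icc 0 1 := by
  rintro _ ⟨t, ht, rfl⟩
  refine ⟨t / 3, ⟨by linarith [ht.1], by linarith [ht.2]⟩, ?_⟩
  rw [osgoodArc, glue_div_three _ _ _ _ ht]

/-- **The Osgood arc has positive area** (at least `1/4`, the area of the dust). [folklore] -/
theorem volume_image_osgoodArc_pos : 0 < volume (osgoodArc '' Icc 0 1) :=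
  volume_dust_root_pos.trans_le
    (measure_mono ((dust_subset_image root).trans image_lim_root_subset))

end OsgoodArc

open OsgoodArc in
/-- **Osgood's theorem (1903): a Jordan arc of positive area.** There is a curve `γ : ℝ → ℂ`,
continuous, injective on `[0, 1]`, from `γ 0 = 0` to `γ 1 = 1`, with `γ([0, 1])` inside the closed
unit square, whose trace `γ '' [0, 1]` has positive planar Lebesgue measure. Osgood's original
example; the construction formalised here threads a fat Cantor dust (area `≥ 1/4`) by straight
bridges. [cite: Osgood1903, pp. 107–112 (the theorem of the title)] -/
theorem exists_osgoodArc :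
    ∃ γ : ℝ → ℂ, Continuous γ ∧ Set.InjOn γ (Set.Icc 0 1) ∧ γ 0 = 0 ∧ γ 1 = 1 ∧
      (∀ t ∈ Set.Icc (0 : ℝ) 1, (γ t).re ∈ Set.Icc (0 : ℝ) 1 ∧ (γ t).im ∈ Set.Icc (0 : ℝ) 1) ∧
      0 < MeasureTheory.volume (γ '' Set.Icc (0 : ℝ) 1) :=
  ⟨osgoodArc, continuous_osgoodArc, injOn_osgoodArc, osgoodArc_zero, osgoodArc_one,
    fun _ ht => osgoodArc_mem ht, volume_image_osgoodArc_pos⟩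

end Literature.Topology.PlaneTopology
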